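import Summits.AtomisticToContinuum.Crystallization.Theorems.ChessboardParticlePlanesLjPlaneChessboardPartnerLoad

/-!
# Crux `ChessboardParticlePlanes.LjPlaneChessboard` (stmt-AtomisticToContinuum-6709), line `Sketch` —
# partner accounting with COMPLEX (phased) weights

The certificate blocks of the crux couple two `2/3`-separated layers `S`, `T` with complex weights
`α, β ∈ ℂ` (Bloch phases of the vertical period appear across the period boundary), so the
real-space half of the hard-core certificate is needed in the form
`0 ≤ ‖α‖² Σ_{S×S} Ψ(dist) + ‖β‖² Σ_{T×T} Ψ(dist) − Re(conj α · β) · (Σ_{S×T} Ψ(dist) + Σ_{T×S} Ψ(dist))`.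
Compared with the real-weight version `twoColour_weighted_sum_nonneg` the sign of `Re(conj α · β)` is
not controlled, so a TWO-SIDED bound on the cross sums is required:

* `partnerLoad_ge` — if `Ψ` vanishes outside the hard-core disk (`Ψ d = 0` for `2/3 ≤ d`), is
  bounded below by `−Ψ0/6`, and (packing input, the neighbouring stub `partnerCount_le_six`, taken
  here as a hypothesis) a `2/3`-separated planar set has at most `6` points at distance `< 2/3` from
  any point, then every partner load is `≥ −Ψ 0`;
* `crossSum_ge_neg_min_card_mul` — hence `Σ_{S×T} Ψ(dist) ≥ −min(|S|,|T|) Ψ0` (sum the loads over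
  `S`, or after `Finset.sum_comm` over `T`);
* `partnerAccountingPhased` — the registered stub: with `m = min(|S|,|T|)`, `X = Σ_{S×T} + Σ_{T×S}`,
  `|X| ≤ 2 m Ψ0` and `|Re(conj α β)| ≤ ‖α‖ ‖β‖` give
  `‖α‖²|S|Ψ0 + ‖β‖²|T|Ψ0 − Re(conj α β) X ≥ m Ψ0 (‖α‖ − ‖β‖)² ≥ 0`.

[folklore; the "partner accounting" of the crux idea card `mismatch-field-certificate`]
-/

noncomputable section

namespace Summit.AtomisticToContinuum.Crystallization.Theorems.ChessboardParticlePlanesLjPlaneChessboard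

open Finset

/-- **Lower partner load.**  Suppose every `2/3`-separated finite planar set has at most `6` points
at distance `< 2/3` from any given point.  If `0 ≤ Ψ 0`, `Ψ d = 0` for `2/3 ≤ d` and
`−Ψ0/6 ≤ Ψ d` for all `d`, then for every `2/3`-separated finite planar `T` and every point `x`,
`−Ψ 0 ≤ ∑_{y ∈ T} Ψ(dist x y)`: only the `≤ 6` points with `dist x y < 2/3` contribute, each at
least `−Ψ0/6`. [folklore] -/
theorem partnerLoad_ge
    (hsix : ∀ (x : EuclideanSpace ℝ (Fin 2)) (Y : Finset (EuclideanSpace ℝ (Fin 2))),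
      (∀ y ∈ Y, ∀ y' ∈ Y, y ≠ y' → (2 : ℝ) / 3 ≤ dist y y') → (∀ y ∈ Y, dist x y < 2 / 3) →
      Y.card ≤ 6)
    (Ψ : ℝ → ℝ) (hΨ0 : 0 ≤ Ψ 0) (hsupp : ∀ d : ℝ, (2 : ℝ) / 3 ≤ d → Ψ d = 0)
    (hfloor : ∀ d : ℝ, -(Ψ 0) / 6 ≤ Ψ d) (T : Finset (EuclideanSpace ℝ (Fin 2)))
    (x : EuclideanSpace ℝ (Fin 2)) (hT : ∀ y ∈ T, ∀ y' ∈ T, y ≠ y' → (2 : ℝ) / 3 ≤ dist y y') :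
    -(Ψ 0) ≤ ∑ y ∈ T, Ψ (dist x y) := by
  classical
  have hsplit := Finset.sum_filter_add_sum_filter_not T (fun y => dist x y < 2 / 3)
    (fun y => Ψ (dist x y))
  rw [← hsplit]
  have hfar : ∑ y ∈ T.filter (fun y => ¬ dist x y < 2 / 3), Ψ (dist x y) = 0 := by
    refine Finset.sum_eq_zero fun y hy => ?_
    rw [Finset.mem_filter] at hy
    exact hsupp _ (not_lt.1 hy.2)
  rw [hfar, add_zero]
  have hcard : (T.filter fun y => dist x y < 2 / 3).card ≤ 6 := by
    refine hsix x _ ?_ ?_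
    · intro y hy y' hy' hne
      rw [Finset.mem_filter] at hy hy'
      exact hT y hy.1 y' hy'.1 hne
    · intro y hy
      rw [Finset.mem_filter] at hy
      exact hy.2
  have hnear : (T.filter fun y => dist x y < 2 / 3).card • (-(Ψ 0) / 6)
      ≤ ∑ y ∈ T.filter (fun y => dist x y < 2 / 3), Ψ (dist x y) :=
    Finset.card_nsmul_le_sum _ _ _ fun y _ => hfloor _
  rw [nsmul_eq_mul] at hnear
  have hcardR : ((T.filter fun y => dist x y < 2 / 3).card : ℝ) ≤ 6 := by exact_mod_cast hcard
  nlinarith [mul_nonneg (sub_nonneg.2 hcardR) hΨ0]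

/-- **Lower cross sum.**  Under the hypotheses of `partnerLoad_ge`, for two `2/3`-separated finite
planar sets `S`, `T`: `−min(|S|,|T|) · Ψ 0 ≤ Σ_{x ∈ S} Σ_{y ∈ T} Ψ(dist x y)` — the cross sum is a
sum of `|S|` partner loads, and after `Finset.sum_comm` and `dist_comm` a sum of `|T|` partner
loads. [folklore] -/
theorem crossSum_ge_neg_min_card_mul
    (hsix : ∀ (x : EuclideanSpace ℝ (Fin 2)) (Y : Finset (EuclideanSpace ℝ (Fin 2))),
      (∀ y ∈ Y, ∀ y' ∈ Y, y ≠ y' → (2 : ℝ) / 3 ≤ dist y y') → (∀ y ∈ Y, dist x y < 2 / 3) →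
      Y.card ≤ 6)
    (Ψ : ℝ → ℝ) (hΨ0 : 0 ≤ Ψ 0) (hsupp : ∀ d : ℝ, (2 : ℝ) / 3 ≤ d → Ψ d = 0)
    (hfloor : ∀ d : ℝ, -(Ψ 0) / 6 ≤ Ψ d) (S T : Finset (EuclideanSpace ℝ (Fin 2)))
    (hS : ∀ y ∈ S, ∀ y' ∈ S, y ≠ y' → (2 : ℝ) / 3 ≤ dist y y')
    (hT : ∀ y ∈ T, ∀ y' ∈ T, y ≠ y' → (2 : ℝ) / 3 ≤ dist y y') :
    -(min (S.card : ℝ) (T.card : ℝ) * Ψ 0) ≤ ∑ x ∈ S, ∑ y ∈ T, Ψ (dist x y) := by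
  have h1 : -((S.card : ℝ) * Ψ 0) ≤ ∑ x ∈ S, ∑ y ∈ T, Ψ (dist x y) := by
    calc -((S.card : ℝ) * Ψ 0) = ∑ _x ∈ S, -(Ψ 0) := by
          rw [Finset.sum_const, nsmul_eq_mul, mul_neg]
      _ ≤ ∑ x ∈ S, ∑ y ∈ T, Ψ (dist x y) :=
          Finset.sum_le_sum fun x _ => partnerLoad_ge hsix Ψ hΨ0 hsupp hfloor T x hT
  have h2 : -((T.card : ℝ) * Ψ 0) ≤ ∑ x ∈ S, ∑ y ∈ T, Ψ (dist x y) := by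
    rw [Finset.sum_comm]
    calc -((T.card : ℝ) * Ψ 0) = ∑ _y ∈ T, -(Ψ 0) := by
          rw [Finset.sum_const, nsmul_eq_mul, mul_neg]
      _ ≤ ∑ y ∈ T, ∑ x ∈ S, Ψ (dist y x) :=
          Finset.sum_le_sum fun y _ => partnerLoad_ge hsix Ψ hΨ0 hsupp hfloor S y hS
      _ = ∑ y ∈ T, ∑ x ∈ S, Ψ (dist x y) :=
          Finset.sum_congr rfl fun y _ => Finset.sum_congr rfl fun x _ => by rw [dist_comm]
  rcases le_total (S.card : ℝ) (T.card : ℝ) with h | h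
  · rw [min_eq_left h]; exact h1
  · rw [min_eq_right h]; exact h2

/-- **Phased (complex-weight) partner accounting in the plane (registered sub-goal of
`stub_deficitCore`).**  Assume the packing input: every `2/3`-separated finite planar set has at most
`6` points at distance `< 2/3` from any point.  Let `Ψ : ℝ → ℝ` satisfy `0 ≤ Ψ 0`, `Ψ d ≤ Ψ 0`
(`d < 1/3`), `Ψ d ≤ 0` (`1/3 ≤ d`), `Ψ d = 0` (`2/3 ≤ d`) and `−Ψ0/6 ≤ Ψ d`.  Then for complex
weights `α, β` and two `2/3`-separated finite planar sets `S`, `T`: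
`0 ≤ ‖α‖² Σ_{S×S} Ψ(dist) + ‖β‖² Σ_{T×T} Ψ(dist) − Re(conj α · β) (Σ_{S×T} Ψ(dist) + Σ_{T×S} Ψ(dist))`.
Proof: same-colour sums are `|S| Ψ0`, `|T| Ψ0` (`sameColour_sum_eq`); with `m = min(|S|,|T|)` the
cross sums lie in `[−m Ψ0, m Ψ0]` (`crossSum_le_min_card_mul`, `crossSum_ge_neg_min_card_mul`), and
`|Re(conj α β)| ≤ ‖α‖ ‖β‖`, so the form is `≥ ‖α‖² m Ψ0 + ‖β‖² m Ψ0 − 2 ‖α‖ ‖β‖ m Ψ0 ≥ 0`.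
[folklore] -/
theorem partnerAccountingPhased :
    (∀ (x : EuclideanSpace ℝ (Fin 2)) (Y : Finset (EuclideanSpace ℝ (Fin 2))),
      (∀ y ∈ Y, ∀ y' ∈ Y, y ≠ y' → (2 : ℝ) / 3 ≤ dist y y') → (∀ y ∈ Y, dist x y < 2 / 3) →
      Y.card ≤ 6) →
    ∀ (Ψ : ℝ → ℝ), 0 ≤ Ψ 0 → (∀ d : ℝ, d < 1 / 3 → Ψ d ≤ Ψ 0) → (∀ d : ℝ, 1 / 3 ≤ d → Ψ d ≤ 0) →
      (∀ d : ℝ, (2 : ℝ) / 3 ≤ d → Ψ d = 0) → (∀ d : ℝ, -(Ψ 0) / 6 ≤ Ψ d) →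
      ∀ (α β : ℂ) (S T : Finset (EuclideanSpace ℝ (Fin 2))),
      (∀ y ∈ S, ∀ y' ∈ S, y ≠ y' → (2 : ℝ) / 3 ≤ dist y y') →
      (∀ y ∈ T, ∀ y' ∈ T, y ≠ y' → (2 : ℝ) / 3 ≤ dist y y') →
      0 ≤ ‖α‖ ^ 2 * (∑ x ∈ S, ∑ y ∈ S, Ψ (dist x y)) + ‖β‖ ^ 2 * (∑ x ∈ T, ∑ y ∈ T, Ψ (dist x y))
          - (starRingEnd ℂ α * β).re *
              ((∑ x ∈ S, ∑ y ∈ T, Ψ (dist x y)) + (∑ x ∈ T, ∑ y ∈ S, Ψ (dist x y))) := by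
  intro hsix Ψ hΨ0 hin hout hsupp hfloor α β S T hS hT
  rw [sameColour_sum_eq Ψ hsupp S hS, sameColour_sum_eq Ψ hsupp T hT]
  have hST := crossSum_le_min_card_mul Ψ hΨ0 hin hout S T hS hT
  have hTS := crossSum_le_min_card_mul Ψ hΨ0 hin hout T S hT hS
  have hST' := crossSum_ge_neg_min_card_mul hsix Ψ hΨ0 hsupp hfloor S T hS hT
  have hTS' := crossSum_ge_neg_min_card_mul hsix Ψ hΨ0 hsupp hfloor T S hT hS
  rw [min_comm] at hTS hTS'
  set m := min (S.card : ℝ) (T.card : ℝ) with hm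
  have hmS : m ≤ (S.card : ℝ) := min_le_left _ _
  have hmT : m ≤ (T.card : ℝ) := min_le_right _ _
  have hm0 : 0 ≤ m := le_min (Nat.cast_nonneg _) (Nat.cast_nonneg _)
  set C := (∑ x ∈ S, ∑ y ∈ T, Ψ (dist x y)) + (∑ x ∈ T, ∑ y ∈ S, Ψ (dist x y)) with hC
  have hCabs : |C| ≤ 2 * (m * Ψ 0) := by
    rw [abs_le]
    constructor <;> linarith
  set r := (starRingEnd ℂ α * β).re with hr
  have hrabs : |r| ≤ ‖α‖ * ‖β‖ := by
    calc |r| ≤ ‖starRingEnd ℂ α * β‖ := Complex.abs_re_le_norm _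
      _ = ‖α‖ * ‖β‖ := by rw [norm_mul, Complex.norm_conj]
  have hrC : r * C ≤ ‖α‖ * ‖β‖ * (2 * (m * Ψ 0)) := by
    calc r * C ≤ |r * C| := le_abs_self _
      _ = |r| * |C| := abs_mul r C
      _ ≤ ‖α‖ * ‖β‖ * (2 * (m * Ψ 0)) :=
          mul_le_mul hrabs hCabs (abs_nonneg _) (mul_nonneg (norm_nonneg _) (norm_nonneg _))
  have hkey : ‖α‖ * ‖β‖ * (2 * (m * Ψ 0))
      ≤ ‖α‖ ^ 2 * ((S.card : ℝ) * Ψ 0) + ‖β‖ ^ 2 * ((T.card : ℝ) * Ψ 0) := by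
    have e1 : ‖α‖ ^ 2 * (m * Ψ 0) ≤ ‖α‖ ^ 2 * ((S.card : ℝ) * Ψ 0) :=
      mul_le_mul_of_nonneg_left (mul_le_mul_of_nonneg_right hmS hΨ0) (sq_nonneg _)
    have e2 : ‖β‖ ^ 2 * (m * Ψ 0) ≤ ‖β‖ ^ 2 * ((T.card : ℝ) * Ψ 0) :=
      mul_le_mul_of_nonneg_left (mul_le_mul_of_nonneg_right hmT hΨ0) (sq_nonneg _)
    have e3 : 0 ≤ (‖α‖ - ‖β‖) ^ 2 * (m * Ψ 0) := mul_nonneg (sq_nonneg _) (mul_nonneg hm0 hΨ0)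
    nlinarith
  linarith

end Summit.AtomisticToContinuum.Crystallization.Theorems.ChessboardParticlePlanesLjPlaneChessboard

end
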